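import Literature.NumberTheory.Automorphic.UnitaryThreeTraceTorusJZeroHceTrace                 -- (LH5-p04) `hce_traceTorus_jzero_of_rel`: case (e) of the `j = 0` column at the trace literal, over ★ p852089 (XShape)
import Literature.NumberTheory.Rogawski1990.UnitOrbitalIntegralInertCountJZeroTorusAllTrace   -- ★ p852186 (LH5-p04): TorusAllTrace HEAD 2 `finsum_natCard_fixedPoints_traceTorusOne_eq_phiZero` (the `j = 0` column over ★ p852020 (α), contract (V2))
import Literature.NumberTheory.Rogawski1990.UnitOrbitalIntegralInertCountJPosClosedTrace      -- ★ p852149 (LH5-p05): `natCard_cosets_traceTorus_eq_iTen_of_rel_of_package` (the `j ≥ 2` columns, Prop. 8 numbers discharged)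
import Literature.NumberTheory.Rogawski1990.UnitOrbitalIntegralInertCountJPosVanishingTrace   -- ★ p852062: `natCard_cosets_traceTorus_eq_zero_of_lt` (`j > N` ⇒ 0), `coe_radial_inv_mul_block_mul_radial`
import Literature.NumberTheory.Automorphic.UnitaryThreeTorusDoubleCosetsHKWeightTrace          -- ★ p851978 F4 (LH5-p01): `relIndex_flickerKH_conj_diagRadial_traceTorus_eq` (the weights, `ε = 0`)
import Literature.NumberTheory.Rogawski1990.UnitOrbitalIntegralInertValueThetaZeroClosed       -- ★ the `e = ½` sibling: the setting, ★ `subgroupOf_flickerHK_eq` (via ★ `…ValueThetaOneClosed`), `phiZero`, `iTen`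
import Literature.NumberTheory.Automorphic.UnitOrbitalIntegralUnfoldingHKTrace                -- ★ p851996 (C0a) (F0P2-p02): `natCard_fixedPoints_unitaryInt_eq_finsum_flickerU_of_rel`, `finite_setOf_nonempty_fixedPoints_flickerU_of_rel`
import Literature.NumberTheory.Rogawski1990.FlickerScalarsTraceCMSharp                         -- ★ p851923 (this seat): `valued_eq_one_of_add_map_eq_one` (a trace seed in `𝒪` is a unit)
import HarnessLib

/-!
# The `θ̄ = 0` VALUE in the TRACE FRAME: `#{q ∈ U⧸K : t₁^{(b)}·q = q} = φ₀(N₁, N₂, N)` with frame∕bridge data as hypotheses — every residue characteristic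
# (Flicker 1998 Prop. 5 p. 82, Prop. 13 p. 91, Prop. 14 p. 94; the 2-free twin of ★ `…ValueThetaZeroClosed` + ★ `…ValueThetaZeroComplete`)

Topic `NumberTheory/Rogawski1990`; namespace `Literature.NumberTheory.Automorphic.UnitaryGroup`.  THEOREMS ONLY (no definition, no instance, no notation, no named fact,
no `sorry`); kernel lane `--supports stmt-HodgeConjecture-24833`; count-neutral.  Cell `pub/hodgecm-mathlib`, crux H413; LAYER C of the (D-UNR) in-house type-(1) programme,
block (C5)′ «VALUES» (LH3-p02 (g6) CENSUS-C5 bd72510a §6: `…ValueThetaZeroTrace` = ★ Closed + ★ Complete MERGED), LH4-plan (g7) WORD #50∕#58 (seat LH7-p03 (g5)); exponent contract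
(V2) of WORD #50.

**`natCard_fixedPoints_unitaryInt_traceTorus_eq_phiZero`** — for `t = t₁^{(b)}(x₁,x₂,x₃)` the θ̄ = 0 trace literal (★ F1 p851889; `b + σb = 1`, `|b| ≤ 1`, `|σb − b| = 1` (T7),
`xᵢ` of norm one) in `Z(c)`, `c = diag(1,−1,1)`, with the 2-free level elements `u_m^{(y,z)}` (★ p851802: `z + σz + yσy = 0`, `|y| = 1`, `|z| ≤ 1`), the radial family `r`,
an integer bridge `(R, ι, σR)` with a GENERATOR `gR` (`σR gR − gR` a unit, T1), `#𝓀 = q²`, and the (V2) regime datum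
`(N₁ < N ∧ N₂ = N₁ ∧ Np = N₁ ∧ |E| = |ϖ^{N₁}|) ∨ (N ≤ N₁ ∧ N ≤ Np ∧ |E| ≤ |ϖ^N|)`, `E = (x₁ − x₂)σb + (x₃ − x₂)b`:
`#{q ∈ U⧸K : t·q = q} = phiZero q N₁ N₂ N`.  Binders = ★ `…Complete.natCard_fixedPoints_unitaryInt_flickerTorusOne_eq_phiZero` :164 with the WORD #50 surgery
(`{y}(hy) ↦ {y z}(hyv)(hzv)(hz)`, `hum ↦ hu`, `{dR}(hdRσ)(hdRu)(h2R) ↦ {gR}(hgR)`, `{e a b cc}(h2e)(ha)(hb)(hcc) ↦ (h2) … {b}(hb)(hbv)(hbδ) {x₁ x₂ x₃}(hx₁)(hx₂)(hx₃)`, trace literal,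
`(hNp)(h) ↦ (V2)`); conclusion VERBATIM.

PROOF = ★ Closed :80–:98 re-threaded: `#Fix_{U⧸K}(t) = Σᶠ_m #Fix_t(H ⧸ H ∩ u_m K u_m⁻¹)` (★ p851996 (C0a) unfolding over the 2-free double-coset decomposition
`U = ⨆_m H u_m^{(y,z)} K`), `H ∩ u_m K u_m⁻¹ = H^K_m` inside `H = Z(c)` (★ `subgroupOf_flickerHK_eq`), and the column sum `Σᶠ_m #Fix_t(H⧸H^K_m) = phiZero` = LH5-p04's
★ p852186 TorusAllTrace HEAD 2 (the `j = 0` column over ★ p852020 (α)), whose abstract binders are discharged here BY NAME: the weights `hW` by ★ F4 p851978 (`ε = 0`), the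
`j ≥ 2` columns `hIpos` by ★ p852149 at the radial conjugate literal (★ `coe_radial_inv_mul_block_mul_radial`, `π₁ = ϖ^{2i}`), the vanishing columns `hIvan` by ★ p852062,
case (e) `hce` by LH5-p04's `hce_traceTorus_jzero_of_rel` (over ★ p852089 XShape).  The (V2) datum feeds ★ p852149's `hNp`: type A verbatim; type B with `E ≠ 0` through
`Np′ := ord E ≥ N` and `iTen_congr_of_lt` (`iTen q ν Np m` does not read `Np > ν`); type B with `E = 0` is FINDING #18's family, where `v_sub_eq_one_of_traceCorner_eq_zero`
(T7 `|σb − b| = 1` + norm one) gives `N = 0`, so the `j ≥ 2` column is empty.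

HONEST LABEL: HC_CM is proved only modulo the 7 printed citations (2 remaining: hLiu418 = `stmt-HodgeConjecture-24832`, h413 = `stmt-HodgeConjecture-24833`) until rung 0
closes; (D-UNR) stays PRINT by D74′; this file asserts cell values only through the (C3)′∕(C5)′ column heads it calls (R0∕D1 of WORD #46); pays no organ, opens no road.

## References
* [Flicker1998UnitaryFL] Y. Z. Flicker, *Elementary proof of the fundamental lemma for a unitary group*, Canad. J. Math. 50 (1998), Prop. 5 p. 82, Prop. 13 pp. 91–93, Prop. 14 p. 94.
* [Rogawski1990] J. D. Rogawski, *Automorphic Representations of Unitary Groups in Three Variables* (1990), §4.9 Prop. 4.9.1 p. 55.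
-/

set_option autoImplicit false

open scoped MatrixGroups WithZero Valued
open Matrix

namespace Literature.NumberTheory.Automorphic

namespace UnitaryGroup

open Literature.NumberTheory.Automorphic.HermitianLattice (unitaryInt mem_unitaryInt_iff UnramifiedLocalConjDatum)
open Literature.NumberTheory.Rogawski1990.Flicker1998 (phiZero iTen)
open Literature.NumberTheory.Rogawski1990 (valued_eq_one_of_add_map_eq_one)
open IsLocalRing

universe u

variable {K : Type*} [Field K] [Valued K ℤᵐ⁰] {ϖ : K} (σ : K →+* K) {J : Matrix (Fin 3) (Fin 3) K}



section Letters

/-- `iTen q ν Np m` does not read `Np` once `ν < Np` (★ `…Piecewise` :44–:48: `min (ν∕2) (Np∕2) = ν∕2`, and the clause `ν = Np` is off) — the (V2) contract's reason.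
[cite: Flicker1998UnitaryFL, Prop. 10 p. 85] -/
theorem iTen_congr_of_lt {q ν Np Np' m : ℕ} (h1 : ν < Np) (h2 : ν < Np') : iTen q ν Np m = iTen q ν Np' m := by
  have e1 : min (ν / 2) (Np / 2) = ν / 2 := min_eq_left (Nat.div_le_div_right h1.le)
  have e2 : min (ν / 2) (Np' / 2) = ν / 2 := min_eq_left (Nat.div_le_div_right h2.le)
  simp only [iTen, e1, e2, h1.ne, h2.ne, false_and, if_false]

/-- **`E = 0` forces `|x₁ − x₃| = 1` under T7**: for norm-one `x₁ x₂ x₃` with `x₁ ≠ x₃`, a trace seed `b` (`b + σb = 1`, `|b| ≤ 1`) with `|σb − b| = 1`, and `σ` an isometric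
involution, `(x₁ − x₂)σb + (x₃ − x₂)b = 0` implies `x₃ b² = x₁ (σb)²`, whence `x₁ − x₃ = x₁(b − σb)(b + σb)∕b²` is a unit — FINDING #18's degenerate family
`(ζω, ζ, ζω⁻¹)`, `ω = b∕σb`, is residually REGULAR (`N = 0`). [cite: Flicker1998UnitaryFL, Prop. 13 p. 91] -/
theorem v_sub_eq_one_of_traceCorner_eq_zero (hσσ : ∀ x, σ (σ x) = x) (hσv : ∀ x, Valued.v (σ x) = Valued.v x)
    {b : K} (hb : b + σ b = 1) (hbv : Valued.v b ≤ 1) (hbδ : Valued.v (σ b - b) = 1)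
    {x₁ x₂ x₃ : K} (hx₁ : σ x₁ * x₁ = 1) (hx₂ : σ x₂ * x₂ = 1) (hx₃ : σ x₃ * x₃ = 1) (h13 : x₁ ≠ x₃)
    (hE : (x₁ - x₂) * σ b + (x₃ - x₂) * b = 0) : Valued.v (x₁ - x₃) = 1 := by
  have hb1 : Valued.v b = 1 := valued_eq_one_of_add_map_eq_one σ hσv hb hbv
  have hb0 : b ≠ 0 := fun h0 => by rw [h0, map_zero] at hb1; exact zero_ne_one hb1
  have hσb0 : σ b ≠ 0 := fun h0 => by
    have := hσv b; rw [h0, map_zero, hb1] at this; exact zero_ne_one this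
  have hx₁0 : x₁ ≠ 0 := fun h0 => by rw [h0, mul_zero] at hx₁; exact zero_ne_one hx₁
  have hx₂0 : x₂ ≠ 0 := fun h0 => by rw [h0, mul_zero] at hx₂; exact zero_ne_one hx₂
  have hx₃0 : x₃ ≠ 0 := fun h0 => by rw [h0, mul_zero] at hx₃; exact zero_ne_one hx₃
  have hσx₁ : σ x₁ = x₁⁻¹ := eq_inv_of_mul_eq_one_left hx₁
  have hσx₂ : σ x₂ = x₂⁻¹ := eq_inv_of_mul_eq_one_left hx₂
  have hσx₃ : σ x₃ = x₃⁻¹ := eq_inv_of_mul_eq_one_left hx₃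
  -- apply `σ` to `E = 0` and clear denominators: `(x₁ − x₂) x₃ b + (x₃ − x₂) x₁ σb = 0`
  have hσE : (x₁⁻¹ - x₂⁻¹) * b + (x₃⁻¹ - x₂⁻¹) * σ b = 0 := by
    have h0 := congrArg σ hE
    rw [map_add, map_mul, map_mul, map_sub, map_sub, hσσ, hσx₁, hσx₂, hσx₃, map_zero] at h0
    exact h0
  have h2' : (x₁ - x₂) * x₃ * b + (x₃ - x₂) * x₁ * σ b = 0 := by
    have h0 := congrArg (fun w => w * (x₁ * x₂ * x₃)) hσE
    simp only [zero_mul] at h0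
    have e : ((x₁⁻¹ - x₂⁻¹) * b + (x₃⁻¹ - x₂⁻¹) * σ b) * (x₁ * x₂ * x₃) = -((x₁ - x₂) * x₃ * b + (x₃ - x₂) * x₁ * σ b) := by
      field_simp
      ring
    rw [e, neg_eq_zero] at h0
    exact h0
  have key : (x₃ - x₂) * (x₃ * b ^ 2 - x₁ * σ b ^ 2) = 0 := by
    linear_combination (x₃ * b) * hE - (σ b) * h2'
  rcases mul_eq_zero.1 key with h32 | hsq
  · -- `x₃ = x₂` forces `x₁ = x₂` too, contradicting `x₁ ≠ x₃`
    have h32' : x₃ = x₂ := sub_eq_zero.1 h32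
    rw [h32', sub_self, zero_mul, add_zero] at hE
    rcases mul_eq_zero.1 hE with h12 | h0
    · exact absurd ((sub_eq_zero.1 h12).trans h32'.symm) h13
    · exact absurd h0 hσb0
  · have hx13 : x₁ - x₃ = x₁ * (b - σ b) * (b + σ b) / b ^ 2 := by
      field_simp
      linear_combination -hsq
    rw [hx13, hb, mul_one, map_div₀, map_mul, map_pow, hb1, one_pow, div_one, Valuation.map_sub_swap, hbδ, mul_one]
    have := congrArg Valued.v hx₁
    rw [map_mul, hσv, map_one] at this
    exact Literature.NumberTheory.QuadraticForms.OMeara65.WithZeroMulInt.eq_one_of_mul_self this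

end Letters

section ValueThetaZero

variable [IsDiscreteValuationRing 𝒪[K]] [Finite (ResidueField 𝒪[K])] [IsAdicComplete (maximalIdeal 𝒪[K]) 𝒪[K]]

set_option synthInstance.maxHeartbeats 200000 in
-- the `H`-action on `H ⧸ (K^{u_m} ∩ H)` is found through the large subgroup terms of the `U(2,1)` frame (as in ★ (F2))
/-- **THE θ̄ = 0 VALUE IN THE TRACE FRAME, every residue characteristic**: for `t = t₁^{(b)}(x₁,x₂,x₃)` (trace literal, `b + σb = 1`, `|b| ≤ 1`, `|σb − b| = 1` (T7), norm-one `xᵢ`),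
`#{q ∈ U⧸K : t q = q} = phiZero q N₁ N₂ N` with frame∕bridge data as hypotheses and the (V2) regime datum — ★ `…Complete.natCard_fixedPoints_unitaryInt_flickerTorusOne_eq_phiZero` with
`{y}(hy) ↦ {y z}(hyv)(hzv)(hz)`, `hum ↦ hu` (the 2-free level elements `u_m^{(y,z)}` of ★ p851802), `{dR}(hdRσ)(hdRu)(h2R) ↦ {gR}(hgR)` (T1), `{e a b cc}(h2e)(ha)(hb)(hcc) ↦ (h2) … {b}(hb)(hbv)(hbδ)
{x₁ x₂ x₃}(hx₁)(hx₂)(hx₃)` (T2∕T3∕T7), the trace literal, `(hNp)(h) ↦ (V2)`; conclusion VERBATIM.  Chain: ★ p851996 (C0a) unfolding `#Fix_{U⧸K}(t) = Σᶠ_m #Fix_t(H⧸H^K_m)` ∘ LH5-p04's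
TorusAllTrace HEAD 2 (the `j = 0` column over ★ p852020 (α)). [cite: Flicker1998UnitaryFL, Prop. 5 p. 82; Prop. 13 p. 91; Prop. 14 p. 94] [cite: Rogawski1990, §4.9 Prop. 4.9.1 p. 55] -/
theorem natCard_fixedPoints_unitaryInt_traceTorus_eq_phiZero (hJ : J = (StdForm.antidiagonal 3).over K) (hd : UnramifiedLocalConjDatum σ ϖ)
    (h2 : (2 : K) ≠ 0)
    (hσO : ∀ y : 𝒪[K], (σ.comp 𝒪[K].subtype) y ∈ 𝒪[K])
    {y z : K} (hyv : Valued.v y = 1) (hzv : Valued.v z ≤ 1) (hz : z + σ z + y * σ y = 0)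
    {c : ↥(unitaryGroupOfForm σ J)} (hc : ((c : GL (Fin 3) K) : Matrix (Fin 3) (Fin 3) K) = !![1, 0, 0; 0, -1, 0; 0, 0, 1])
    (u : ℕ → ↥(unitaryGroupOfForm σ J))
    (hu : ∀ m, ((u m : GL (Fin 3) K) : Matrix (Fin 3) (Fin 3) K) = !![ϖ ^ m, y, z * (ϖ ^ m)⁻¹; 0, 1, -σ y * (ϖ ^ m)⁻¹; 0, 0, (ϖ ^ m)⁻¹])
    {R : Type u} [CommRing R] [IsDomain R] [IsDiscreteValuationRing R] [Finite (ResidueField R)] (ι : R →+* K) (hι : Function.Injective ι)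
    (hιv : ∀ x : K, Valued.v x ≤ 1 ↔ x ∈ Set.range ι) (σR : R →+* R) (hσR : ∀ r, σR (σR r) = r) (hσι : ∀ r, ι (σR r) = σ (ι r))
    {gR : R} (hgR : IsUnit (σR gR - gR)) {ϖR : R} (hϖR : Irreducible ϖR) (hιϖ : ι ϖR = ϖ)
    {q : ℕ} (hqR : Nat.card (ResidueField R) = q ^ 2) (hq : Nat.card (ResidueField 𝒪[K]) = q ^ 2)
    {a₀ : 𝒪[K]} (ha₀ : IsUnit (((σ.comp 𝒪[K].subtype).codRestrict 𝒪[K] hσO) a₀ - a₀))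
    {b : K} (hb : b + σ b = 1) (hbv : Valued.v b ≤ 1) (hbδ : Valued.v (σ b - b) = 1)
    {x₁ x₂ x₃ : K} (hx₁ : σ x₁ * x₁ = 1) (hx₂ : σ x₂ * x₂ = 1) (hx₃ : σ x₃ * x₃ = 1)
    {t : ↥(unitaryGroupOfForm σ J)}
    (hte : ((t : GL (Fin 3) K) : Matrix (Fin 3) (Fin 3) K) =
      !![x₁ * σ b + x₃ * b, 0, x₁ - x₃; 0, x₂, 0; b * σ b * (x₁ - x₃), 0, x₁ * b + x₃ * σ b])
    (htH : t ∈ Subgroup.centralizer ({c} : Set ↥(unitaryGroupOfForm σ J)))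
    (r : ℕ → ↥(Subgroup.centralizer ({c} : Set ↥(unitaryGroupOfForm σ J))))
    (hr : ∀ i, (((r i : ↥(unitaryGroupOfForm σ J)) : GL (Fin 3) K) : Matrix (Fin 3) (Fin 3) K) = !![(ϖ ^ i)⁻¹, 0, 0; 0, 1, 0; 0, 0, ϖ ^ i])
    {N Np N₁ N₂ : ℕ} (hN : Valued.v (x₁ - x₃) = Valued.v (ϖ ^ N))
    (hN₁ : Valued.v (x₁ - x₂) = Valued.v (ϖ ^ N₁)) (hN₂ : Valued.v (x₃ - x₂) = Valued.v (ϖ ^ N₂))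
    (h : (N₁ < N ∧ N₂ = N₁ ∧ Np = N₁ ∧ Valued.v ((x₁ - x₂) * σ b + (x₃ - x₂) * b) = Valued.v (ϖ ^ N₁)) ∨
      (N ≤ N₁ ∧ N ≤ Np ∧ Valued.v ((x₁ - x₂) * σ b + (x₃ - x₂) * b) ≤ Valued.v (ϖ ^ N)))
    (hfin : {x : ↥(unitaryGroupOfForm σ J) ⧸ unitaryInt σ J | t • x = x}.Finite) :
    (Nat.card {x : ↥(unitaryGroupOfForm σ J) ⧸ unitaryInt σ J | t • x = x} : ℚ) = phiZero q N₁ N₂ N := by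
  have hS : ∀ m, (flickerHK σ J c (u m)).subgroupOf (Subgroup.centralizer ({c} : Set ↥(unitaryGroupOfForm σ J))) =
      ((unitaryInt σ J).map (MulAut.conj (u m)).toMonoidHom).subgroupOf (Subgroup.centralizer ({c} : Set ↥(unitaryGroupOfForm σ J))) :=
    fun m => subgroupOf_flickerHK_eq σ c (u m)
  have hlev := finite_setOf_nonempty_fixedPoints_flickerU_of_rel σ hJ hd h2 hyv hzv hz hc u hu htH hfin
  have hfinm : ∀ m, {x : ↥(Subgroup.centralizer ({c} : Set ↥(unitaryGroupOfForm σ J))) ⧸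
      (flickerHK σ J c (u m)).subgroupOf (Subgroup.centralizer ({c} : Set ↥(unitaryGroupOfForm σ J))) |
        (⟨t, htH⟩ : ↥(Subgroup.centralizer ({c} : Set ↥(unitaryGroupOfForm σ J)))) • x = x}.Finite := fun m => by
    rw [hS m]; exact Set.finite_coe_iff.1 (hlev.2 m)
  rw [natCard_fixedPoints_unitaryInt_eq_finsum_flickerU_of_rel σ hJ hd h2 hyv hzv hz hc u hu htH hfin]
  have hsupp : (Function.support fun m => Nat.card {w : ↥(Subgroup.centralizer ({c} : Set ↥(unitaryGroupOfForm σ J))) ⧸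
      ((unitaryInt σ J).map (MulAut.conj (u m)).toMonoidHom).subgroupOf (Subgroup.centralizer ({c} : Set ↥(unitaryGroupOfForm σ J))) |
        (⟨t, htH⟩ : ↥(Subgroup.centralizer ({c} : Set ↥(unitaryGroupOfForm σ J)))) • w = w}).Finite := by
    refine hlev.1.subset fun m hm => ?_
    rw [Function.mem_support] at hm
    exact (Nat.card_ne_zero.1 hm).1
  have hcast := (Nat.castAddMonoidHom ℚ).map_finsum hsupp
  simp only [Nat.coe_castAddMonoidHom] at hcast
  -- scalar facts
  have hϖ0 : ϖ ≠ 0 := hd.ϖ_ne_zero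
  have hx13 : x₁ ≠ x₃ := by
    intro h0; rw [h0, sub_self, map_zero] at hN; exact pow_ne_zero N hϖ0 ((Valuation.zero_iff _).1 hN.symm)
  have vle : ∀ {i j : ℕ}, Valued.v (ϖ ^ i) ≤ Valued.v (ϖ ^ j) ↔ j ≤ i := fun {i j} => by rw [hd.v_pow, hd.v_pow, WithZero.exp_le_exp]; omega
  -- the literal in `π = π′ = 1` form (★ F4 ∕ ★ Vanishing shapes) and the radial family in `ϖ⁻¹ ^ i` form
  have hte1 : ((t : GL (Fin 3) K) : Matrix (Fin 3) (Fin 3) K) =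
      !![x₁ * σ b + x₃ * b, 0, 1 * (x₁ - x₃); 0, x₂, 0; 1 * (b * σ b * (x₁ - x₃)), 0, x₁ * b + x₃ * σ b] := by
    rw [hte, one_mul, one_mul]
  have hr' : ∀ i, (((r i : ↥(unitaryGroupOfForm σ J)) : GL (Fin 3) K) : Matrix (Fin 3) (Fin 3) K) = !![ϖ⁻¹ ^ i, 0, 0; 0, 1, 0; 0, 0, ϖ ^ i] := by
    intro i; rw [hr i, inv_pow]
  -- the weights (★ F4 at `ε = 0`, `π = π′ = 1`)
  have hW : ∀ i, ((((flickerKH σ J c).subgroupOf (Subgroup.centralizer ({c} : Set ↥(unitaryGroupOfForm σ J)))).map (MulAut.conj (r i)).toMonoidHom).relIndex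
      (Subgroup.centralizer ({(⟨t, htH⟩ : ↥(Subgroup.centralizer ({c} : Set ↥(unitaryGroupOfForm σ J))))} : Set ↥(Subgroup.centralizer ({c} : Set ↥(unitaryGroupOfForm σ J))))) =
      if 2 * i + 0 = 0 then 1 else (q + 1) * q ^ (2 * i + 0 - 1)) := fun i =>
    relIndex_flickerKH_conj_diagRadial_traceTorus_eq σ hJ hd h2 ι hι hιv σR hσR hσι hgR hϖR hιϖ hqR hc (π := 1) (π' := 1) (ε := 0) (pow_zero ϖ).symm (mul_one 1)
      hb hbv htH hte1 hx13 r hr i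
  -- the vanishing columns `j = 2i > N` (★ p852062)
  have hIvan : ∀ i m, N < 2 * i → Nat.card {w : ↥(flickerPH σ J c) ⧸ (flickerHK σ J c (u m)).subgroupOf (flickerPH σ J c) //
      ((Quotient.out w : ↥(flickerPH σ J c)) : ↥(unitaryGroupOfForm σ J))⁻¹ *
        ((r i : ↥(unitaryGroupOfForm σ J))⁻¹ * t * (r i : ↥(unitaryGroupOfForm σ J))) * (Quotient.out w : ↥(flickerPH σ J c)) ∈ flickerHK σ J c (u m)} = 0 :=
    fun i m hlt => natCard_cosets_traceTorus_eq_zero_of_lt σ hJ hd h2 hyv hz hc (hu m) hb hbv (θbar := 0) (by rw [pow_zero, inv_one]) hte1 (hr' i) hN (by omega)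
  -- the `j = 2i ≥ 2` columns (★ p852149), with the (V2) datum feeding `hNp`
  have hIpos : ∀ i m, 1 ≤ i → 2 * i ≤ N → (Nat.card {w : ↥(flickerPH σ J c) ⧸ (flickerHK σ J c (u m)).subgroupOf (flickerPH σ J c) //
      ((Quotient.out w : ↥(flickerPH σ J c)) : ↥(unitaryGroupOfForm σ J))⁻¹ *
        ((r i : ↥(unitaryGroupOfForm σ J))⁻¹ * t * (r i : ↥(unitaryGroupOfForm σ J))) * (Quotient.out w : ↥(flickerPH σ J c)) ∈ flickerHK σ J c (u m)} : ℚ) =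
        iTen q (N - 2 * i) Np m := by
    intro i m hi hiN
    -- the conjugate `(r_i)⁻¹ t r_i` is the trace literal with `π₁ = ϖ^i ϖ^i`
    have hti : ((((r i : ↥(unitaryGroupOfForm σ J))⁻¹ * t * (r i : ↥(unitaryGroupOfForm σ J)) : ↥(unitaryGroupOfForm σ J)) : GL (Fin 3) K) : Matrix (Fin 3) (Fin 3) K) =
        !![x₁ * σ b + x₃ * b, 0, (ϖ ^ i * ϖ ^ i) * (x₁ - x₃); 0, x₂, 0; (ϖ⁻¹ ^ i * ϖ⁻¹ ^ i) * (b * σ b * (x₁ - x₃)), 0, x₁ * b + x₃ * σ b] := by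
      rw [coe_radial_inv_mul_block_mul_radial σ hϖ0 i hte (hr' i), mul_comm (x₁ - x₃), mul_comm (b * σ b * (x₁ - x₃))]
    have hππ : (ϖ ^ i * ϖ ^ i) * (ϖ⁻¹ ^ i * ϖ⁻¹ ^ i) = 1 := by
      rw [inv_pow]; field_simp
    have hσπ : σ (ϖ ^ i * ϖ ^ i) = ϖ ^ i * ϖ ^ i := by rw [map_mul, map_pow, hd.σϖ]
    have hπj : Valued.v (ϖ ^ i * ϖ ^ i) = Valued.v (ϖ ^ (2 * i)) := by rw [← pow_add, two_mul]
    -- `hNp` in ★ p852149's shape: type A verbatim; type B via `Np′ := ord E` (or `E = 0 ⇒ N = 0`, vacuous) and `iTen`'s `Np`-independence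
    rcases h with ⟨-, -, hNpeq, hNpA⟩ | ⟨hNN₁, hNNp, hEle⟩
    · rw [hNpeq]
      exact natCard_cosets_traceTorus_eq_iTen_of_rel_of_package σ hJ hd h2 hσO hyv hzv hz hc (hu m) hb hbv hππ hσπ hπj hx₁ hx₂ hx₃ hti
        (Subgroup.inv_mem _ (r i).2 |> fun h1 => Subgroup.mul_mem _ (Subgroup.mul_mem _ h1 htH) (r i).2) hN hNpA (by omega) hiN hq ha₀
    · by_cases hE0 : (x₁ - x₂) * σ b + (x₃ - x₂) * b = 0
      · -- the degenerate family: `N = 0`, so there is no `j ≥ 2` column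
        exfalso
        have h1 := v_sub_eq_one_of_traceCorner_eq_zero σ hd.σσ hd.vσ hb hbv hbδ hx₁ hx₂ hx₃ hx13 hE0
        rw [hN, hd.v_pow, ← WithZero.exp_zero, WithZero.exp_inj] at h1
        omega
      · -- `Np′ := ord E ≥ N`
        have hvE0 : Valued.v ((x₁ - x₂) * σ b + (x₃ - x₂) * b) ≠ 0 := (Valuation.ne_zero_iff _).2 hE0
        have hvE1 : Valued.v ((x₁ - x₂) * σ b + (x₃ - x₂) * b) ≤ 1 := hEle.trans (hd.v_pow_le_one N)
        obtain ⟨Np', hNp'⟩ : ∃ Np' : ℕ, Valued.v ((x₁ - x₂) * σ b + (x₃ - x₂) * b) = Valued.v (ϖ ^ Np') := by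
          refine ⟨(-WithZero.log (Valued.v ((x₁ - x₂) * σ b + (x₃ - x₂) * b))).toNat, ?_⟩
          have hlog : WithZero.log (Valued.v ((x₁ - x₂) * σ b + (x₃ - x₂) * b)) ≤ 0 := by
            rw [← WithZero.exp_le_exp, WithZero.exp_log hvE0, WithZero.exp_zero]; exact hvE1
          rw [hd.v_pow, Int.toNat_of_nonneg (by omega), neg_neg, WithZero.exp_log hvE0]
        have hNNp' : N ≤ Np' := by rw [hNp'] at hEle; exact vle.1 hEle
        rw [natCard_cosets_traceTorus_eq_iTen_of_rel_of_package σ hJ hd h2 hσO hyv hzv hz hc (hu m) hb hbv hππ hσπ hπj hx₁ hx₂ hx₃ hti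
          (Subgroup.inv_mem _ (r i).2 |> fun h1 => Subgroup.mul_mem _ (Subgroup.mul_mem _ h1 htH) (r i).2) hN hNp' (by omega) hiN hq ha₀]
        exact iTen_congr_of_lt (by omega) (by omega)
  -- case (e) of the `j = 0` column (LH5-p04's discharger over ★ p852089)
  have hce := hce_traceTorus_jzero_of_rel σ hJ hd h2 hσO hyv hzv hz hc u hu hb hbv hx₁ hx₂ hx₃ t hN hN₁ hN₂ h hq ha₀
  rw [hcast, ← finsum_natCard_fixedPoints_traceTorusOne_eq_phiZero σ hJ hd h2 hσO hyv hzv hz hc u hu ι hι hιv σR hσR hσι hgR hϖR hιϖ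
    hb hbv hx₁ hx₂ hx₃ hte htH r hr hq ha₀ hW hN hN₁ hN₂ h hIpos hIvan hce hfinm]
  refine finsum_congr fun m => ?_
  rw [hS m]
  rfl

end ValueThetaZero

end UnitaryGroup

end Literature.NumberTheory.Automorphic
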